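import Literature.MathematicalPhysics.QuantumFieldTheory.ConformalBootstrap3D.PointKernelK57Data
import Literature.MathematicalPhysics.QuantumFieldTheory.ConformalBootstrap3D.PointKernelParts

/-!
# K57 certificate, kernel part file P12: one-cell head segments 150, 151 in level ranges

The head cells whose kernel evaluation exceeds one `decide` are one-cell segments of `hsegsK57`; each is
checked by `PCert.hPartSideOK` (side conditions) and `PCert.hPartOK` per level range `[n_lo, n_lo + count)`
against an integer claim, the claims summing to `≥ 0` (`PointKernel.partsOK`); soundness is
`PCert.hParts_sound` (`PointKernelParts`).  The part files `P1, P2, …` are mutually independent (each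
imports only the data file); the ranges of one cell may span several of them, and the per-cell
conclusions `hparts_i` / `hcell_i` of those cells are assembled in `PointKernelK57.lean`.
Estimated kernel time 170 s.
-/

set_option maxRecDepth 100000
set_option maxHeartbeats 0

namespace Literature.MathematicalPhysics.QuantumFieldTheory.ConformalBootstrap3D.PointKernelK57

open Literature.MathematicalPhysics.QuantumFieldTheory.ConformalBootstrap3D.PointKernel

/-- levels `[26, 37)` of segment 150: partial lower sum `≥` claim. [folklore] -/
theorem part_150_1 : certK57.hPartOK (PCert.segAt hsegsK57 150) JHK57 26 11 (8523838760891616245783365540850890116) = true := by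
  decide +kernel

/-- levels `[37, 45)` of segment 150: partial lower sum `≥` claim. [folklore] -/
theorem part_150_2 : certK57.hPartOK (PCert.segAt hsegsK57 150) JHK57 37 8 (2329410432573514491827096706954543236) = true := by
  decide +kernel

/-- levels `[45, 49)` of segment 150: partial lower sum `≥` claim. [folklore] -/
theorem part_150_3 : certK57.hPartOK (PCert.segAt hsegsK57 150) JHK57 45 4 (534903202154003574066205243272656124) = true := by
  decide +kernel

/-- one-cell segment 151 (row 6, cell `[897/128, 1795/256]`, chord, `n_F = 56`,
7 level ranges): side conditions. [folklore] -/
theorem pside_151 : certK57.hPartSideOK (PCert.segAt hsegsK57 151) JHK57 = true := by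
  decide +kernel

/-- its level ranges `(n_lo, count, claim)`. [folklore] -/
def parts_151 : List (ℕ × ℕ × ℤ) := [(0, 24, -13857847764102086706933452659954441354), (24, 10, 9046578358498668484566146207889050576), (34, 7, 2854763476171721086588224583709500439), (41, 6, 1182143033790031536214932876986535489), (47, 5, 513963171040026849992155595744646031), (52, 4, 233641683635729581573493849702188609), (56, 1, 26758040965909167998499545922520210)]

/-- the ranges tile `[0, n_F]` and the claims sum to `≥ 0`. [folklore] -/
theorem pcov_151 : PointKernel.partsOK 56 parts_151 = true := by
  decide +kernel

end Literature.MathematicalPhysics.QuantumFieldTheory.ConformalBootstrap3D.PointKernelK57
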